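import Literature.NumberTheory.Automorphic.HidaLatticeLevelControlOne
import HarnessLib

/-!
# Top-degree control on the `U_p`-ordinary parts for the Hida levels `U(c,c) ⊴ U(b₁,c)`

Topic `NumberTheory/Automorphic`; namespace `Literature.NumberTheory.Automorphic.BigHeckeGLn.TameLevel`;
theorems only (no named fact, no `sorry`).

The ordinary refinements of B3/B4 (`HidaLatticeLevelControlTwo`) for `U = U(c,c) ⊴ U' = U(b₁,c)`
(`e_v c₀ ≤ b₁ ≤ c`, `1 ≤ c`), arbitrary flat coefficients `τ` on the integral monoid of a family of
places above `p`, FINITE cohomology, torus sections `d_q`, `Ord = ⋂_{w∣p} ⋂ₙ range U_{w,1}ⁿ`: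

* **`exists_mem_ordAtΔ_trCohomology_eq_two`** — `tr : Ord H²(U, τ) → Ord H²(U', τ)` is onto
  (B3 and the bijectivity of `∏_w U_{w,1}` on the finite ordinary parts);
* **`exists_eq_sum_diamond_sub_of_mem_ordAtΔ_two`** — an ordinary `x` with `tr x = 0` is
  `∑_q (⟨d_q⟩ b_q − b_q)` with ORDINARY `b_q` (B4, same device);
* **`exists_eq_smul_add_sum_of_mem_ordAtΔ_two`** — an ordinary `x` with `tr x ∈ ϖ · Ord H²(U', τ)` is
  `ϖ x'' + ∑_q (⟨d_q⟩ b_q − b_q)` with `x''`, `b_q` ordinary.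

[cite: KhareThorne2017, §6.3, Prop. 6.6] [cite: Hida1994AIF, §3, Thm 3.2]

## References

* C. Khare, J. A. Thorne, Amer. J. Math. 139 (2017), §6.3 (arXiv:1409.7007, held). [KhareThorne2017]
* H. Hida, Ann. Inst. Fourier 44 (1994), §3 (held). [Hida1994AIF]
-/

noncomputable section

open CategoryTheory IsDedekindDomain
open scoped NumberField

namespace Literature.NumberTheory.Automorphic

namespace BigHeckeGLn

namespace TameLevel

open IntegralWeightGL2 LevelAction ParallelWeight

variable {K : Type} [Field K] [NumberField K] {p : ℕ} [Fact p.Prime] (𝒰 : TameLevel 2 K p)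
  {R : Type} [CommRing R] {V : Type} [AddCommGroup V] [Module R V] [Module.Flat R V]
  {E : Type} [Field E] {v : (K →+* E) → HeightOneSpectrum (𝓞 K)} (hv : ∀ τ, (p : 𝓞 K) ∈ (v τ).asIdeal)
  (τ : integralMonoid K v →* Module.End R V)
  (h𝒰 : 𝒰.IsMaximalAbove) {c₀ b₁ c : ℕ} (hb₁ : ∀ w : PlacesAbove K p, BigHeckeGLn.ordAt w.1 (p : 𝓞 K) * c₀ ≤ b₁)
  (hbc : b₁ ≤ c) (hc : 1 ≤ c) [((𝒰.level c c).subgroupOf (𝒰.level b₁ c)).Normal]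
  (hcd : ∀ (W : Subgroup (FiniteAdelicGL 2 K)),
    IsOpen (W : Set (FiniteAdelicGL 2 K)) → IsCompact (W : Set (FiniteAdelicGL 2 K)) →
    (∀ γ ∈ W.comap (globalEmbedding 2 K), IsOfFinOrder γ → γ = 1) →
    ∀ (A : Rep ℤ (W.comap (globalEmbedding 2 K))) (q : ℕ), 3 ≤ q → Subsingleton (groupCohomology A q))
  (htf : ∀ (x : FiniteAdelicGL 2 K) (γ : GL (Fin 2) K), IsOfFinOrder γ →
    x⁻¹ * globalEmbedding 2 K γ * x ∈ 𝒰.level b₁ c → γ = 1)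
  [Finite (cohomology (globalEmbedding 2 K) (integralMonoid K v) τ (𝒰.level b₁ c) 2)]
  [Finite (cohomology (globalEmbedding 2 K) (integralMonoid K v) τ (𝒰.level c c) 2)]

/-! ### The products `∏_w U_{w,1}` at the two levels -/

omit [Module.Flat R V] [((𝒰.level c c).subgroupOf (𝒰.level b₁ c)).Normal]
  [Finite (cohomology (globalEmbedding 2 K) (integralMonoid K v) τ (𝒰.level b₁ c) 2)]
  [Finite (cohomology (globalEmbedding 2 K) (integralMonoid K v) τ (𝒰.level c c) 2)] in
include h𝒰 hbc hc hv in
/-- `tr ∘ Pⁿ = P'ⁿ ∘ tr` for the products `P`, `P'` of the `U_{w,1}` at the two levels. [folklore] -/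
theorem trCohomology_pow_noncommProd_apply (i n : ℕ)
    (x : cohomology (globalEmbedding 2 K) (integralMonoid K v) τ (𝒰.level c c) i) :
    (trCohomology (globalEmbedding 2 K) (integralMonoid K v) τ (𝒰.level_le_integralMonoid_of_forall_mem hv c c)
        (𝒰.level_le_integralMonoid_of_forall_mem hv b₁ c) i).hom
      (((Finset.univ : Finset (PlacesAbove K p)).noncommProd
        (fun w => heckeCohomology (globalEmbedding 2 K) (integralMonoid K v) τ (𝒰.level c c)
          (𝒰.level_le_integralMonoid_of_forall_mem hv c c) (heckeElement_mem_integralMonoid v w.1 1) i)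
        (fun w _ w' _ _ => 𝒰.commute_up_up τ (𝒰.level_le_integralMonoid_of_forall_mem hv c c)
          (fun w : PlacesAbove K p => heckeElement_mem_integralMonoid v w.1 1) h𝒰 i w w') ^ n) x) =
      ((Finset.univ : Finset (PlacesAbove K p)).noncommProd
        (fun w => heckeCohomology (globalEmbedding 2 K) (integralMonoid K v) τ (𝒰.level b₁ c)
          (𝒰.level_le_integralMonoid_of_forall_mem hv b₁ c) (heckeElement_mem_integralMonoid v w.1 1) i)
        (fun w _ w' _ _ => 𝒰.commute_up_up τ (𝒰.level_le_integralMonoid_of_forall_mem hv b₁ c)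
          (fun w : PlacesAbove K p => heckeElement_mem_integralMonoid v w.1 1) h𝒰 i w w') ^ n)
        ((trCohomology (globalEmbedding 2 K) (integralMonoid K v) τ (𝒰.level_le_integralMonoid_of_forall_mem hv c c)
          (𝒰.level_le_integralMonoid_of_forall_mem hv b₁ c) i).hom x) := by
  classical
  set tr := (trCohomology (globalEmbedding 2 K) (integralMonoid K v) τ (𝒰.level_le_integralMonoid_of_forall_mem hv c c)
    (𝒰.level_le_integralMonoid_of_forall_mem hv b₁ c) i).hom with htr
  have hcomp : tr ∘ₗ (Finset.univ : Finset (PlacesAbove K p)).noncommProd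
        (fun w => heckeCohomology (globalEmbedding 2 K) (integralMonoid K v) τ (𝒰.level c c)
          (𝒰.level_le_integralMonoid_of_forall_mem hv c c) (heckeElement_mem_integralMonoid v w.1 1) i)
        (fun w _ w' _ _ => 𝒰.commute_up_up τ (𝒰.level_le_integralMonoid_of_forall_mem hv c c)
          (fun w : PlacesAbove K p => heckeElement_mem_integralMonoid v w.1 1) h𝒰 i w w') =
      (Finset.univ : Finset (PlacesAbove K p)).noncommProd
        (fun w => heckeCohomology (globalEmbedding 2 K) (integralMonoid K v) τ (𝒰.level b₁ c)
          (𝒰.level_le_integralMonoid_of_forall_mem hv b₁ c) (heckeElement_mem_integralMonoid v w.1 1) i)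
        (fun w _ w' _ _ => 𝒰.commute_up_up τ (𝒰.level_le_integralMonoid_of_forall_mem hv b₁ c)
          (fun w : PlacesAbove K p => heckeElement_mem_integralMonoid v w.1 1) h𝒰 i w w') ∘ₗ tr :=
    comp_noncommProd_eq_of_forall tr _ _ _ _ _ fun w _ =>
      𝒰.trCohomology_comp_heckeCohomology_level (Δ := integralMonoid K v) τ h𝒰
        (𝒰.level_le_integralMonoid_of_forall_mem hv c c) (𝒰.level_le_integralMonoid_of_forall_mem hv b₁ c) hbc le_rfl hc i
        (fun w hw x hx => 𝒰.globalUnipotent_mul_heckeElement_mem_integralMonoid h𝒰 hv hw hx)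
        (fun w _ hp y => ofLocal_mem_integralMonoid v (fun τ h => hp (by rw [← h]; exact hv τ)) y)
        (𝒰.heckeElement_mem_hidaElements (Or.inr w.2) 1) (heckeElement_mem_integralMonoid v w.1 1)
  induction n generalizing x with
  | zero => rfl
  | succ n ih =>
    have hx := LinearMap.congr_fun hcomp x
    rw [LinearMap.comp_apply, LinearMap.comp_apply] at hx
    rw [pow_succ, pow_succ, Module.End.mul_apply, Module.End.mul_apply, ih, hx]

include h𝒰 hb₁ hbc hc hcd htf hv in
/-- **`tr : Ord H²(U(c,c), τ) → Ord H²(U(b₁,c), τ)` is onto** (finite cohomology).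
[cite: KhareThorne2017, §6.3, Prop. 6.6] -/
theorem exists_mem_ordAtΔ_trCohomology_eq_two
    (x' : cohomology (globalEmbedding 2 K) (integralMonoid K v) τ (𝒰.level b₁ c) 2)
    (hx' : x' ∈ ordAtΔ (globalEmbedding 2 K) (integralMonoid K v) τ
      (fun w : PlacesAbove K p => heckeElement_mem_integralMonoid v w.1 1) (𝒰.level_le_integralMonoid_of_forall_mem hv b₁ c) 2) :
    ∃ x ∈ ordAtΔ (globalEmbedding 2 K) (integralMonoid K v) τ
        (fun w : PlacesAbove K p => heckeElement_mem_integralMonoid v w.1 1) (𝒰.level_le_integralMonoid_of_forall_mem hv c c) 2,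
      (trCohomology (globalEmbedding 2 K) (integralMonoid K v) τ (𝒰.level_le_integralMonoid_of_forall_mem hv c c)
        (𝒰.level_le_integralMonoid_of_forall_mem hv b₁ c) 2).hom x = x' := by
  classical
  have hUp : ∀ w : PlacesAbove K p, heckeElement 2 K w.1 1 ∈ integralMonoid K v :=
    fun w => heckeElement_mem_integralMonoid v w.1 1
  set hU := 𝒰.level_le_integralMonoid_of_forall_mem hv c c with hhU
  set hU' := 𝒰.level_le_integralMonoid_of_forall_mem hv b₁ c with hhU'
  set P := (Finset.univ : Finset (PlacesAbove K p)).noncommProd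
    (fun w => heckeCohomology (globalEmbedding 2 K) (integralMonoid K v) τ (𝒰.level c c) hU (hUp w) 2)
    (fun w _ w' _ _ => 𝒰.commute_up_up τ hU hUp h𝒰 2 w w') with hP
  set P' := (Finset.univ : Finset (PlacesAbove K p)).noncommProd
    (fun w => heckeCohomology (globalEmbedding 2 K) (integralMonoid K v) τ (𝒰.level b₁ c) hU' (hUp w) 2)
    (fun w _ w' _ _ => 𝒰.commute_up_up τ hU' hUp h𝒰 2 w w') with hP'
  have hordP : (ordAtΔ (globalEmbedding 2 K) (integralMonoid K v) τ hUp hU 2 : Submodule R _) =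
      ⨅ n : ℕ, LinearMap.range (P ^ n) := ordAtΔ_eq_iInf_range_pow_noncommProd hU 2 _
  have hordP' : (ordAtΔ (globalEmbedding 2 K) (integralMonoid K v) τ hUp hU' 2 : Submodule R _) =
      ⨅ n : ℕ, LinearMap.range (P' ^ n) := ordAtΔ_eq_iInf_range_pow_noncommProd hU' 2 _
  obtain ⟨L, hL⟩ := exists_iInf_range_pow_eq P
  -- `x' = P'^L x''` with `x''` ordinary, `x'' = tr x₁`
  have hx'P : x' ∈ (⨅ n : ℕ, LinearMap.range (P' ^ n) : Submodule R _) := by rw [← hordP']; exact hx'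
  obtain ⟨x'', hx'', rfl⟩ := surjOn_pow_of_injOn_of_mapsTo P' (Set.toFinite _) (mapsTo_iInf_range_pow_self P')
    (OrdFinite.bijOn_iInf_range_pow P').injOn L hx'P
  obtain ⟨x₁, rfl⟩ := 𝒰.trCohomology_surjective_level_two τ h𝒰 hb₁ hbc hc hU hU' hcd htf x''
  refine ⟨(P ^ L) x₁, ?_, ?_⟩
  · rw [hordP, hL L le_rfl]
    exact LinearMap.mem_range_self _ _
  · exact 𝒰.trCohomology_pow_noncommProd_apply hv τ h𝒰 hbc hc 2 L x₁

include hcd htf hv in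
/-- **An ordinary `x ∈ H²(U(c,c), τ)` with `tr x = 0` is `∑_q (⟨d_q⟩ b_q − b_q)` with ordinary `b_q`**
(finite cohomology). [cite: KhareThorne2017, §6.3, Prop. 6.6] [cite: Hida1994AIF, §3, Thm 3.2] -/
theorem exists_eq_sum_diamond_sub_of_mem_ordAtΔ_two
    (x : cohomology (globalEmbedding 2 K) (integralMonoid K v) τ (𝒰.level c c) 2)
    (hx : x ∈ ordAtΔ (globalEmbedding 2 K) (integralMonoid K v) τ
      (fun w : PlacesAbove K p => heckeElement_mem_integralMonoid v w.1 1) (𝒰.level_le_integralMonoid_of_forall_mem hv c c) 2)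
    (hx0 : (trCohomology (globalEmbedding 2 K) (integralMonoid K v) τ (𝒰.level_le_integralMonoid_of_forall_mem hv c c)
        (𝒰.level_le_integralMonoid_of_forall_mem hv b₁ c) 2).hom x = 0) :
    ∃ b : (𝒰.level b₁ c ⧸ (𝒰.level c c).subgroupOf (𝒰.level b₁ c)) →
        cohomology (globalEmbedding 2 K) (integralMonoid K v) τ (𝒰.level c c) 2,
      (∀ q, b q ∈ ordAtΔ (globalEmbedding 2 K) (integralMonoid K v) τ
        (fun w : PlacesAbove K p => heckeElement_mem_integralMonoid v w.1 1) (𝒰.level_le_integralMonoid_of_forall_mem hv c c) 2) ∧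
      x = ∑ q, (heckeCohomology (globalEmbedding 2 K) (integralMonoid K v) τ (𝒰.level c c)
        (𝒰.level_le_integralMonoid_of_forall_mem hv c c)
        (𝒰.level_le_integralMonoid_of_forall_mem hv b₁ c (𝒰.torusSectionElt h𝒰 hb₁ hbc hc q).2) 2 (b q) - b q) := by
  classical
  have hUp : ∀ w : PlacesAbove K p, heckeElement 2 K w.1 1 ∈ integralMonoid K v :=
    fun w => heckeElement_mem_integralMonoid v w.1 1
  set hU := 𝒰.level_le_integralMonoid_of_forall_mem hv c c with hhU
  set hU' := 𝒰.level_le_integralMonoid_of_forall_mem hv b₁ c with hhU'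
  set P := (Finset.univ : Finset (PlacesAbove K p)).noncommProd
    (fun w => heckeCohomology (globalEmbedding 2 K) (integralMonoid K v) τ (𝒰.level c c) hU (hUp w) 2)
    (fun w _ w' _ _ => 𝒰.commute_up_up τ hU hUp h𝒰 2 w w') with hP
  set P' := (Finset.univ : Finset (PlacesAbove K p)).noncommProd
    (fun w => heckeCohomology (globalEmbedding 2 K) (integralMonoid K v) τ (𝒰.level b₁ c) hU' (hUp w) 2)
    (fun w _ w' _ _ => 𝒰.commute_up_up τ hU' hUp h𝒰 2 w w') with hP'
  have hordP : (ordAtΔ (globalEmbedding 2 K) (integralMonoid K v) τ hUp hU 2 : Submodule R _) =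
      ⨅ n : ℕ, LinearMap.range (P ^ n) := ordAtΔ_eq_iInf_range_pow_noncommProd hU 2 _
  have hordP' : (ordAtΔ (globalEmbedding 2 K) (integralMonoid K v) τ hUp hU' 2 : Submodule R _) =
      ⨅ n : ℕ, LinearMap.range (P' ^ n) := ordAtΔ_eq_iInf_range_pow_noncommProd hU' 2 _
  obtain ⟨L, hL⟩ := exists_iInf_range_pow_eq P
  -- `x = P^L x₁` with `x₁` ordinary
  have hxP : x ∈ (⨅ n : ℕ, LinearMap.range (P ^ n) : Submodule R _) := by rw [← hordP]; exact hx
  obtain ⟨x₁, hx₁, rfl⟩ := surjOn_pow_of_injOn_of_mapsTo P (Set.toFinite _) (mapsTo_iInf_range_pow_self P)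
    (OrdFinite.bijOn_iInf_range_pow P).injOn L hxP
  -- `tr x₁` is ordinary and killed by `P'^L`, hence zero
  set tr := (trCohomology (globalEmbedding 2 K) (integralMonoid K v) τ hU hU' 2).hom with htr
  have htrP : tr ∘ₗ P = P' ∘ₗ tr :=
    comp_noncommProd_eq_of_forall tr _ _ _ _ _ fun w _ =>
      𝒰.trCohomology_comp_heckeCohomology_level (Δ := integralMonoid K v) τ h𝒰 hU hU' hbc le_rfl hc 2
        (fun w hw x hx => 𝒰.globalUnipotent_mul_heckeElement_mem_integralMonoid h𝒰 hv hw hx)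
        (fun w _ hp y => ofLocal_mem_integralMonoid v (fun τ h => hp (by rw [← h]; exact hv τ)) y)
        (𝒰.heckeElement_mem_hidaElements (Or.inr w.2) 1) (hUp w)
  have htr₁ord : tr x₁ ∈ (⨅ n : ℕ, LinearMap.range (P' ^ n) : Submodule R _) := by
    rw [← hordP']
    have hx₁' : x₁ ∈ (ordAtΔ (globalEmbedding 2 K) (integralMonoid K v) τ hUp hU 2 : Submodule R _) := by
      rw [hordP]; exact hx₁
    simp only [ordAtΔ, Submodule.mem_iInf] at hx₁' ⊢
    intro w
    exact (Submodule.mem_iInf _).1 (mapsTo_iInf_range_pow_of_comp_eq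
      (𝒰.trCohomology_comp_heckeCohomology_level (Δ := integralMonoid K v) τ h𝒰 hU hU' hbc le_rfl hc 2
        (fun w hw x hx => 𝒰.globalUnipotent_mul_heckeElement_mem_integralMonoid h𝒰 hv hw hx)
        (fun w _ hp y => ofLocal_mem_integralMonoid v (fun τ h => hp (by rw [← h]; exact hv τ)) y)
        (𝒰.heckeElement_mem_hidaElements (Or.inr w.2) 1) (hUp w)) ((Submodule.mem_iInf _).2 (hx₁' w)))
  have htr₁ : tr x₁ = 0 := by
    have h0 : (P' ^ L) (tr x₁) = 0 := by
      rw [← 𝒰.trCohomology_pow_noncommProd_apply hv τ h𝒰 hbc hc 2 L x₁]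
      exact hx0
    have hinj : Set.InjOn (P' ^ L) (⨅ n : ℕ, LinearMap.range (P' ^ n) : Submodule R _) := by
      rw [Module.End.coe_pow]
      exact ((OrdFinite.bijOn_iInf_range_pow P').iterate _).injOn
    exact hinj htr₁ord (Submodule.zero_mem _) (by rw [h0, map_zero])
  -- B4 for `x₁`, then apply `P^L`
  obtain ⟨b, hb⟩ := 𝒰.exists_eq_sum_of_trCohomology_eq_zero_level_two τ h𝒰 hb₁ hbc hc hU hU' hcd htf x₁ htr₁
  have hdiam : ∀ q, Commute (heckeCohomology (globalEmbedding 2 K) (integralMonoid K v) τ (𝒰.level c c) hU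
      (hU' (𝒰.torusSectionElt h𝒰 hb₁ hbc hc q).2) 2) P := fun q => by
    rw [hP]
    refine Finset.noncommProd_commute _ _ _ _ fun w _ => ?_
    have h := 𝒰.commute_symOp_up τ hU (c₀ := c₀) (hG := fun _ hg => 𝒰.goodElements_le_integralMonoid v hg)
      (hD := fun u => diamondPi_mem_integralMonoid' v hv u) hUp h𝒰 2 (Sum.inr (𝒰.torusSection h𝒰 hb₁ hbc hc q)) w
    rw [symOp_inr] at h
    exact h
  refine ⟨fun q => (P ^ L) (b q), fun q => ?_, ?_⟩
  · rw [hordP, hL L le_rfl]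
    exact LinearMap.mem_range_self _ _
  · conv_lhs => rw [hb]
    rw [map_sum]
    refine Finset.sum_congr rfl fun q _ => ?_
    rw [map_sub, ← Module.End.mul_apply, ← ((hdiam q).pow_right L).eq, Module.End.mul_apply]

include hcd htf hv in
/-- **An ordinary `x ∈ H²(U(c,c), τ)` with `tr x ∈ ϖ · Ord H²(U(b₁,c), τ)` is
`ϖ x'' + ∑_q (⟨d_q⟩ b_q − b_q)` with `x''`, `b_q` ordinary** (finite cohomology).
[cite: KhareThorne2017, §6.3, Prop. 6.6] [cite: Hida1994AIF, §3, Thm 3.2] -/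
theorem exists_eq_smul_add_sum_of_mem_ordAtΔ_two (ϖ : R)
    (x : cohomology (globalEmbedding 2 K) (integralMonoid K v) τ (𝒰.level c c) 2)
    (hx : x ∈ ordAtΔ (globalEmbedding 2 K) (integralMonoid K v) τ
      (fun w : PlacesAbove K p => heckeElement_mem_integralMonoid v w.1 1) (𝒰.level_le_integralMonoid_of_forall_mem hv c c) 2)
    (hxϖ : ∃ a ∈ ordAtΔ (globalEmbedding 2 K) (integralMonoid K v) τ
        (fun w : PlacesAbove K p => heckeElement_mem_integralMonoid v w.1 1) (𝒰.level_le_integralMonoid_of_forall_mem hv b₁ c) 2,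
      (trCohomology (globalEmbedding 2 K) (integralMonoid K v) τ (𝒰.level_le_integralMonoid_of_forall_mem hv c c)
        (𝒰.level_le_integralMonoid_of_forall_mem hv b₁ c) 2).hom x = ϖ • a) :
    ∃ x'' ∈ ordAtΔ (globalEmbedding 2 K) (integralMonoid K v) τ
        (fun w : PlacesAbove K p => heckeElement_mem_integralMonoid v w.1 1) (𝒰.level_le_integralMonoid_of_forall_mem hv c c) 2,
      ∃ b : (𝒰.level b₁ c ⧸ (𝒰.level c c).subgroupOf (𝒰.level b₁ c)) →
          cohomology (globalEmbedding 2 K) (integralMonoid K v) τ (𝒰.level c c) 2,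
        (∀ q, b q ∈ ordAtΔ (globalEmbedding 2 K) (integralMonoid K v) τ
          (fun w : PlacesAbove K p => heckeElement_mem_integralMonoid v w.1 1) (𝒰.level_le_integralMonoid_of_forall_mem hv c c) 2) ∧
        x = ϖ • x'' + ∑ q, (heckeCohomology (globalEmbedding 2 K) (integralMonoid K v) τ (𝒰.level c c)
          (𝒰.level_le_integralMonoid_of_forall_mem hv c c)
          (𝒰.level_le_integralMonoid_of_forall_mem hv b₁ c (𝒰.torusSectionElt h𝒰 hb₁ hbc hc q).2) 2 (b q) - b q) := by
  obtain ⟨a, ha, hxa⟩ := hxϖ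
  obtain ⟨x'', hx'', rfl⟩ := 𝒰.exists_mem_ordAtΔ_trCohomology_eq_two hv τ h𝒰 hb₁ hbc hc hcd htf a ha
  have h0 : (trCohomology (globalEmbedding 2 K) (integralMonoid K v) τ (𝒰.level_le_integralMonoid_of_forall_mem hv c c)
      (𝒰.level_le_integralMonoid_of_forall_mem hv b₁ c) 2).hom (x - ϖ • x'') = 0 := by
    rw [map_sub, map_smul, hxa, sub_self]
  obtain ⟨b, hb, hsum⟩ := 𝒰.exists_eq_sum_diamond_sub_of_mem_ordAtΔ_two hv τ h𝒰 hb₁ hbc hc hcd htf (x - ϖ • x'')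
    (Submodule.sub_mem _ hx (Submodule.smul_mem _ _ hx'')) h0
  exact ⟨x'', hx'', b, hb, by rw [← hsum, add_sub_cancel]⟩

end TameLevel

end BigHeckeGLn

end Literature.NumberTheory.Automorphic
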